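import Summits.BirchSwinnertonDyer.Rank1Residual.Supersingular.X7TwistClauseOPEN
import Summits.BirchSwinnertonDyer.Rank1Residual.Supersingular.CountPointsFast
import Summits.BirchSwinnertonDyer.Rank1Residual.Supersingular.IntModelMinimalityKrausTwoMore
import Summits.BirchSwinnertonDyer.Rank1Residual.SecondDescent.CanaryTargetsClassCertificates
import Summits.BirchSwinnertonDyer.Rank1Residual.SecondDescent.X10aPrimeTargetsKernelCertificates
import Summits.BirchSwinnertonDyer.BirchSwinnertonDyer.Theorems.SignedLowerHalvesKobayashiLowerHalfSemistableScopeS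
import Literature.NumberTheory.EllipticCurves.ComplexMultiplicationLocalFactorsAux
import HarnessLib
/-!
# Route `SignedLowerHalves`, crux `KobayashiLowerHalfLargeImage` (item stmt-BirchSwinnertonDyer-19001): the
# BSTW-TWIST SUB-FAMILY of class X7 — PER-PAIR RECORD SHAPES (cell `pub/bsd-litref`, paper sub-dir `bstw24`,
# prover seat `bsd-litref-bstw24-pv` gen 6; a `--supports … --as helper` file; THEOREMS ONLY; closes nothing)

HONEST FRAMING (programme BSD-LIT2PART v1 §HONESTY, verbatim): «no tranche here proves BSD; ARM L moves the LITERAL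
column of an r ≤ 1 census into the kernel-proved-modulo-named-print column; ARM P changes what "named print" is
worth.» Burungale–Skinner–Tian–Wan, «Zeta elements for elliptic curves and applications», arXiv:2409.01350v2 is an
UNREFEREED PREPRINT: its twist clause enters ONLY through the tree's explicitly labelled OPEN binders
(`Literature.….BurungaleSkinnerTianWan2024.thm15_twist_pPart_OPEN` — Thm. 1.5 with Thm. 1.3, INTRO wording «disc K
coprime to Np and divisible only by primes of ordinary reduction for E» —, and `….cor102_twist_pPart_OPEN` — Cor.
10.2, BODY wording «disc K coprime to Np», the WIDER clause; the proved edge body ⟹ intro is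
`thm15_twist_of_cor102_twist_OPEN`), NEVER as a theorem — and in THIS file not at all: everything below is binder-free and
UNCONDITIONAL (statements about explicit integer equations); the binders meet the data in `…BSTWTwistConsumers.lean`.
Records ≠ bookings ≠ crux closure; class X7 stays CONSTRUCTION-SHAPED; crux 3 stays OPEN; typed ≠ proved ≠ endorsed.

PARTITION (D-0054): row A7 / class X7 (`GoodSS ∧ ¬Semistable`, `a_p = 0`, odd `p`) × the BSTW-twist sub-family =
the pairs `(E, p)` of the cell census `pub/bsd-ssimc/bsd-ssimc-lev/census/x7census.tsv` (7 165 S-b pairs) with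
`E ≅ E₀ ⊗ χ_K`, `E₀` SEMISTABLE (the conductor-minimal twist), `d_K` coprime to `N_{E₀}·p`: 415 pairs under the BODY
wording, 312 of them under the INTRO wording (every prime of `d_K` good ORDINARY for `E₀`); types-the-object-of; 0 cells move.

WHY (litref lead 2026-08-27T03:04:26Z; W-ALL exclusion row 7): the twist clause is the ONLY print object that bites on
X7; its consumers are kernel-wired CLASS-WIDE (`bsdp_of_thm15_twist_OPEN'`, `bsdp_of_cor102_twist_OPEN`), but membership
of a census pair in the sub-family is a WITNESSED property — a semistable `E₀`, a square-free `d`, a `ℚ`-isomorphism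
`E ≅ E₀^{(d)}`, the clause's side conditions prime by prime — which no class-wide theorem supplies. This file turns it
into KERNEL-DECIDED hypotheses on two literal integer models (pattern: the cell's Mazur–Tate road,
`…LargeImageMazurTateShape.lean` p447529 / `…Records01–51`), so that each pair gets ONE unconditional theorem
`twist_x7bstw_<label>_<p>` in `…BSTWTwistRecordsNN.lean`, consumed by whatever binder the litref D-audit of the twist
clause (sheets `pub/bsd-litref/bstw24/sheets/D-AUDIT-bstw24-r{1,2}-TWIST.md`, referee C4) ends up endorsing; the S-scoped
tiers being typed by `bsd-litref-bstw24-ty` add ONE hypothesis on the twist, `BSTWScope.HasAuxWitness W p`, which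
`hasAuxWitness_of_certs` below certifies per pair from a (ram) prime of `W` (UNCONDITIONAL).

## What this file proves (namespace `Summit.BirchSwinnertonDyer.BirchSwinnertonDyer.Theorems.X7Twist`)

* `smul_eq_quadraticTwist_of_eqs` — the `ℚ`-isomorphism `C • W = W₀.quadraticTwist d` (`C = (u, r, s, t)`,
  Mathlib's `VariableChange` action) from FIVE rational identities between the a-invariants (each `norm_num`-decidable
  on literals); pure algebra.
* `semistable_of_certs`, `goodSS_of_certs`, `frobeniusTrace_eq_zero_of_certs`, `goodOrd_of_certs`,
  `goodOrd_two_of_certs` — the clause's hypotheses on the literal model of `E₀` read off kernel-decidable integer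
  facts: `gcd(Δ₀, c₄(E₀)) = 1` (semistable, `SecondDescent.semistable_of_intModel_of_gcd_eq_one`), `p ∤ Δ₀` and
  `countPoints = p + 1` (`a_p(E₀) = 0`), `q ∤ Δ₀` and `q ∤ q + 1 − countPoints` at an odd ramified `q`
  (`SecondDescent.goodOrd_of_intModel`), and at `q = 2` the affine points over `𝔽₂` counted by `decide`
  (`natCard_point_eq_one_add_card`).
* `ramifiedInQuadratic_cases` — a prime ramified in `ℚ(√d)` (`RamifiedInQuadratic d q`: `q ∣ d`, or `q = 2` and
  `d ≢ 1 (mod 4)`) is `2` with `d ≢ 1 (mod 4)` or an odd prime `≤ |d|` dividing `|d|` — so the clause's universally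
  quantified side condition reduces to a BOUNDED, decidable check over an explicit list `L` of odd primes.
* `exists_twistIntro_of_certs` / `exists_twistBody_of_certs` — the TWIST DATUM of a pair, BINDER-FREE and UNCONDITIONAL:
  `∃ W₀ d C`, `W₀` semistable, `p` good supersingular for `W₀` with `a_p = 0`, `d` square-free `≠ 1`, every ramified
  prime of `ℚ(√d)` `≠ p` and good ORDINARY (intro) resp. GOOD (body) for `W₀`, `C • W = W₀^{(d)}` — from the
  certificates on two literal integer models. This is the «per-pair side conditions» half of the litref L3 step: the
  records prove it ONCE per pair (`twist_x7bstw_<label>_<p>`), and every binder shape — printed, S-scoped, future —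
  consumes it by a class-wide theorem.
* (companion file `…BSTWTwistConsumers.lean`, binder side) `X7Twist.bsdp_of_thm15_twist_OPEN_of_twistIntro`,
  `…_of_cor102_twist_OPEN_of_twistBody`, `…_of_cor102_twist_OPEN_of_twistIntro` — the CLASS-WIDE consumers: `BSDp W p` from a
  twist datum, CONDITIONAL on the PRE binder of the matching wording (+ GZK by name + the analytic rank `≤ 1` as DATA).
* `classX7_of_certs` — the pair IS an X7 pair with `a_p = 0` (`Supersingular.classX7_of_intModel`).
* `ram_of_certs`, `hasAuxWitness_of_certs` — `Ram W p` (a multiplicative `ℓ ≠ p` of `W` with `p ∤ ord_ℓ Δ_min(W)`,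
  read off `ℓ ∣ Δ`, `ℓ ∤ c₄`, `ℓ^v ∥ Δ`, `p ∤ v`) and hence `BSTWScope.HasAuxWitness W p` — the S-scoped tiers' one
  extra hypothesis ON THE TWIST, UNCONDITIONAL (`BSTWScope_hasAuxWitness_of_ram`).

Design: THEOREMS ONLY (no `def`, no named fact, no instance); numerical hypotheses live on the recheck integers `discOf` /
`c4Of` / `countPoints` (`Rank1Residual.X11RankOneCertificates.Schema`), discharged per record by `decide` / `decide +kernel` /
`norm_num` (point counts through `countPoints_eq_of_fast`, `CountPointsFast.lean`); ellipticity and minimality of the literal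
models are INSTANCE hypotheses (records: `isElliptic_of_discOf_ne_zero`, `isGloballyMinimal_of_krausCriterion₃_factored`).
Default heartbeats; axioms standard.
References: [BurungaleSkinnerTianWan2024] arXiv:2409.01350v2 Thm. 1.3/1.5 twist clause (pp. 3–4), Cor. 10.2 (p. 86); [SilvermanAEC2009]
III.1, VII.1 Rem. 1.1, VII.5 Prop. 5.1, X.5 Cor. 5.4; [Knapp1993] Prop. 12.10; [SkinnerUrban2014] Thm. 2 ((ram)); [Cremona2006] Table 1.
-/

set_option autoImplicit false
set_option linter.dupNamespace false

noncomputable section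

open scoped Classical

open WeierstrassCurve Literature.NumberTheory.EllipticCurves
  Literature.NumberTheory.EllipticCurves.Rank1Residual
  Literature.NumberTheory.EllipticCurves.Rank1Residual.X11RankOneCertificates
  Literature.NumberTheory.EllipticCurves.BurungaleSkinnerTianWan2024
  Summit.BirchSwinnertonDyer.BirchSwinnertonDyer.Rank1Residual.IntModel
  Summit.BirchSwinnertonDyer.BirchSwinnertonDyer.Rank1Residual.X11RankOne
  Summit.BirchSwinnertonDyer.Rank1Residual.X11b
  Summit.BirchSwinnertonDyer.Rank1Residual.Supersingular
  Summit.BirchSwinnertonDyer.Rank1Residual.SecondDescent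

namespace Summit.BirchSwinnertonDyer.BirchSwinnertonDyer.Theorems.X7Twist

/-! ### §1 The `ℚ`-isomorphism with the twist model from five rational identities -/

/-- **`C • W = W₀.quadraticTwist d` from five identities.** For literal a-invariants `a₁…a₆` (of `W`) and `b₁…b₆`
(of `W₀`), an integer `d` and rationals `u ≠ 0, r, s, t`: Mathlib's change of variables `C = (u, r, s, t)` carries
`W` to the twist model `W₀.quadraticTwist d = [0, d·b₂/4, 0, d²·b₄/2, d³·b₆/4]` (`b₂ = b₁² + 4b₂`, `b₄ = 2b₄ + b₁b₃`,
`b₆ = b₃² + 4b₆` of `W₀`) as soon as `a₁ + 2s = 0`, `a₃ + r a₁ + 2t = 0` and the three weighted identities for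
`a₂, a₄, a₆` hold (Silverman III.1 Table 3.1 with `u^{i} a_i' = …`). Pure algebra; each hypothesis is decided by
`norm_num` on literals. [cite: SilvermanAEC2009, III.1 Table 3.1] -/
theorem smul_eq_quadraticTwist_of_eqs (a1 a2 a3 a4 a6 b1 b2 b3 b4 b6 d : ℤ) (u r s t : ℚ) (hu : u ≠ 0)
    (h1 : (a1 : ℚ) + 2 * s = 0)
    (h2 : (a2 : ℚ) - s * a1 + 3 * r - s ^ 2 = u ^ 2 * ((d : ℚ) * ((b1 : ℚ) ^ 2 + 4 * b2) / 4))
    (h3 : (a3 : ℚ) + r * a1 + 2 * t = 0)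
    (h4 : (a4 : ℚ) - s * a3 + 2 * r * a2 - (t + r * s) * a1 + 3 * r ^ 2 - 2 * s * t =
      u ^ 4 * ((d : ℚ) ^ 2 * (2 * (b4 : ℚ) + b1 * b3) / 2))
    (h6 : (a6 : ℚ) + r * a4 + r ^ 2 * a2 + r ^ 3 - t * a3 - t ^ 2 - r * t * a1 =
      u ^ 6 * ((d : ℚ) ^ 3 * ((b3 : ℚ) ^ 2 + 4 * b6) / 4)) :
    (⟨Units.mk0 u hu, r, s, t⟩ : VariableChange ℚ) • (⟨a1, a2, a3, a4, a6⟩ : WeierstrassCurve ℚ) =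
      (⟨b1, b2, b3, b4, b6⟩ : WeierstrassCurve ℚ).quadraticTwist (d : ℚ) := by
  have hu2 : u ^ 2 ≠ 0 := pow_ne_zero 2 hu
  have hu4 : u ^ 4 ≠ 0 := pow_ne_zero 4 hu
  have hu6 : u ^ 6 ≠ 0 := pow_ne_zero 6 hu
  ext
  · simp only [variableChange_a₁, quadraticTwist_a₁, Units.val_inv_eq_inv_val, Units.val_mk0]
    rw [h1, mul_zero]
  · simp only [variableChange_a₂, quadraticTwist_a₂, b₂, Units.val_inv_eq_inv_val, Units.val_mk0]
    rw [h2, inv_pow, ← mul_assoc, inv_mul_cancel₀ hu2, one_mul]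
  · simp only [variableChange_a₃, quadraticTwist_a₃, Units.val_inv_eq_inv_val, Units.val_mk0]
    rw [h3, mul_zero]
  · simp only [variableChange_a₄, quadraticTwist_a₄, b₄, Units.val_inv_eq_inv_val, Units.val_mk0]
    rw [h4, inv_pow, ← mul_assoc, inv_mul_cancel₀ hu4, one_mul]
  · simp only [variableChange_a₆, quadraticTwist_a₆, b₆, Units.val_inv_eq_inv_val, Units.val_mk0]
    rw [h6, inv_pow, ← mul_assoc, inv_mul_cancel₀ hu6, one_mul]

/-! ### §2 The clause's hypotheses on the literal model of `E₀`, read off decidable integer facts -/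

section Certs

variable (b1 b2 b3 b4 b6 : ℤ) [hE : (⟨b1, b2, b3, b4, b6⟩ : WeierstrassCurve ℚ).IsElliptic]
  [hM : (⟨b1, b2, b3, b4, b6⟩ : WeierstrassCurve ℚ).IsGloballyMinimal]

omit hE in
/-- The tree's integral model of the literal (globally minimal) curve `[b₁,…,b₆]` is `[b₁,…,b₆]`. [folklore] -/
theorem integralModelInt_lit :
    integralModelInt (⟨b1, b2, b3, b4, b6⟩ : WeierstrassCurve ℚ) = ⟨b1, b2, b3, b4, b6⟩ :=
  integralModelInt_eq_of_map_eq _ (map_mk_int b1 b2 b3 b4 b6)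

/-- **Semistable from `gcd(Δ, c₄) = 1`** on the literal minimal model (`SecondDescent.semistable_of_intModel_of_gcd_eq_one`).
[cite: SilvermanAEC2009, VII.5 Prop. 5.1(a) and (b)] -/
theorem semistable_of_certs (hgcd : Int.gcd (discOf [b1, b2, b3, b4, b6]) (c4Of [b1, b2, b3, b4, b6]) = 1) :
    Semistable (⟨b1, b2, b3, b4, b6⟩ : WeierstrassCurve ℚ) :=
  semistable_of_intModel_of_gcd_eq_one (integralModelInt_lit b1 b2 b3 b4 b6)
    (by rw [intCurve_Δ, intCurve_c₄]; exact hgcd)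

omit hE in
/-- **Good supersingular with `a_p = 0`** at an odd `p` from `p ∤ Δ` and `#Ẽ(𝔽_p) = p + 1` (`countPoints`).
[cite: SilvermanAEC2009, VII.5 Prop. 5.1(a)] [cite: IrelandRosen1990, Prop. 5.1.2 and §8.1] -/
theorem goodSS_of_certs (p : ℕ) [Fact p.Prime] (hp2 : p ≠ 2) (hpΔ : ¬ (p : ℤ) ∣ discOf [b1, b2, b3, b4, b6])
    (hcnt : countPoints [b1, b2, b3, b4, b6] p = (p + 1 : ℕ)) :
    GoodSS (⟨b1, b2, b3, b4, b6⟩ : WeierstrassCurve ℚ) p :=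
  goodSS_of_intModel p (integralModelInt_lit b1 b2 b3 b4 b6) (by rw [intCurve_Δ]; exact hpΔ)
    (natCard_point_eq_of_countPoints b1 b2 b3 b4 b6 p hp2 hpΔ hcnt) (by push_cast; simp)

omit hE in
/-- **`a_p = 0`** at an odd `p` from `p ∤ Δ` and `#Ẽ(𝔽_p) = p + 1`. [cite: SilvermanAEC2009, VII.5 Prop. 5.1(a)] -/
theorem frobeniusTrace_eq_zero_of_certs (p : ℕ) [Fact p.Prime] (hp2 : p ≠ 2)
    (hpΔ : ¬ (p : ℤ) ∣ discOf [b1, b2, b3, b4, b6]) (hcnt : countPoints [b1, b2, b3, b4, b6] p = (p + 1 : ℕ)) :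
    (⟨b1, b2, b3, b4, b6⟩ : WeierstrassCurve ℚ).frobeniusTrace p = 0 := by
  rw [frobeniusTrace_eq (integralModelInt_lit b1 b2 b3 b4 b6)
    (natCard_point_eq_of_countPoints b1 b2 b3 b4 b6 p hp2 hpΔ hcnt)]
  push_cast; ring

omit hE in
/-- **Good ordinary at an odd prime `q`** from `q ∤ Δ` and `q ∤ q + 1 − countPoints` (`SecondDescent.goodOrd_of_intModel`).
[cite: SilvermanAEC2009, VII.5 Prop. 5.1(a)] [cite: IrelandRosen1990, Prop. 5.1.2 and §8.1] -/
theorem goodOrd_of_certs (q : ℕ) [Fact q.Prime] (hq2 : q ≠ 2) (hqΔ : ¬ (q : ℤ) ∣ discOf [b1, b2, b3, b4, b6])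
    (hqa : ¬ (q : ℤ) ∣ (q : ℤ) + 1 - countPoints [b1, b2, b3, b4, b6] q) :
    GoodOrd (⟨b1, b2, b3, b4, b6⟩ : WeierstrassCurve ℚ) q := by
  have hI := integralModelInt_lit b1 b2 b3 b4 b6
  have hc := natCard_point_eq_countPoints b1 b2 b3 b4 b6 q hq2 (by rw [intCurve_Δ]; exact hqΔ)
  refine goodOrd_of_intModel q hI (by rw [intCurve_Δ]; exact hqΔ) rfl ?_
  rw [hc]; exact hqa

omit hE in
/-- **Good ordinary at `q = 2`** from `2 ∤ Δ` and an ODD number of `𝔽₂`-points (`#Ẽ(𝔽₂) = 1 + #{affine solutions}`,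
`a₂ = 3 − #Ẽ(𝔽₂)`; `natCard_point_eq_one_add_card`, decided over the four points of `𝔽₂²`).
[cite: SilvermanAEC2009, VII.5 Prop. 5.1(a)] -/
theorem goodOrd_two_of_certs (h2Δ : ¬ (2 : ℤ) ∣ discOf [b1, b2, b3, b4, b6])
    (hodd : ¬ (2 : ℤ) ∣ (2 : ℤ) + 1 - ((1 + Fintype.card {xy : ZMod 2 × ZMod 2 //
      xy.2 ^ 2 + ((⟨b1, b2, b3, b4, b6⟩ : WeierstrassCurve ℤ).map (Int.castRingHom (ZMod 2))).a₁ * xy.1 * xy.2 +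
        ((⟨b1, b2, b3, b4, b6⟩ : WeierstrassCurve ℤ).map (Int.castRingHom (ZMod 2))).a₃ * xy.2 =
      xy.1 ^ 3 + ((⟨b1, b2, b3, b4, b6⟩ : WeierstrassCurve ℤ).map (Int.castRingHom (ZMod 2))).a₂ * xy.1 ^ 2 +
        ((⟨b1, b2, b3, b4, b6⟩ : WeierstrassCurve ℤ).map (Int.castRingHom (ZMod 2))).a₄ * xy.1 +
        ((⟨b1, b2, b3, b4, b6⟩ : WeierstrassCurve ℤ).map (Int.castRingHom (ZMod 2))).a₆} : ℕ) : ℤ)) :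
    haveI : Fact (Nat.Prime 2) := ⟨Nat.prime_two⟩
    GoodOrd (⟨b1, b2, b3, b4, b6⟩ : WeierstrassCurve ℚ) 2 := by
  haveI : Fact (Nat.Prime 2) := ⟨Nat.prime_two⟩
  have hI := integralModelInt_lit b1 b2 b3 b4 b6
  have hΔ2 : ((⟨b1, b2, b3, b4, b6⟩ : WeierstrassCurve ℤ).map (Int.castRingHom (ZMod 2))).Δ ≠ 0 := by
    rw [WeierstrassCurve.map_Δ, intCurve_Δ]
    intro h
    exact h2Δ ((ZMod.intCast_zmod_eq_zero_iff_dvd _ 2).mp (by simpa using h))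
  have hn := natCard_point_eq_one_add_card _ hΔ2
  refine goodOrd_of_intModel 2 hI (by rw [intCurve_Δ]; exact h2Δ) hn ?_
  exact_mod_cast hodd

/-- **The ramified primes of `ℚ(√d)` are `2` (when `d ≢ 1 (mod 4)` — this covers `2 ∣ d`) or the odd primes dividing
`|d|`, all `≤ |d|`** (`d` square-free, so `d ≠ 0`). Bookkeeping for the clause's side condition.
[cite: BurungaleSkinnerTianWan2024, Thm. 1.3 (twist clause; shape only, nothing asserted)] -/
theorem ramifiedInQuadratic_cases {d : ℤ} (hd : Squarefree d) {q : ℕ} (hq : q.Prime)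
    (h : RamifiedInQuadratic d q) :
    (q = 2 ∧ d % 4 ≠ 1) ∨ (q ≠ 2 ∧ q ∣ d.natAbs ∧ q < d.natAbs + 1) := by
  have hd0 : d ≠ 0 := hd.ne_zero
  by_cases hq2 : q = 2
  · subst hq2
    left
    refine ⟨rfl, ?_⟩
    rcases h with h | ⟨-, h⟩
    · have h2 : (2 : ℤ) ∣ d := by exact_mod_cast h
      omega
    · exact h
  · right
    have hqd : (q : ℤ) ∣ d := h.resolve_right (fun h' ↦ hq2 h'.1)
    have hqd' : q ∣ d.natAbs := Int.natCast_dvd.mp hqd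
    refine ⟨hq2, hqd', Nat.lt_succ_of_le (Nat.le_of_dvd (Int.natAbs_pos.mpr hd0) hqd')⟩

end Certs

/-! ### §3 The twist datum of a pair, from kernel-decidable certificates -/

section Datum

variable (p : ℕ) [Fact p.Prime]
  (a1 a2 a3 a4 a6 b1 b2 b3 b4 b6 : ℤ)
  [hEb : (⟨b1, b2, b3, b4, b6⟩ : WeierstrassCurve ℚ).IsElliptic]
  [hMb : (⟨b1, b2, b3, b4, b6⟩ : WeierstrassCurve ℚ).IsGloballyMinimal]

/-- **The INTRO-wording twist datum of a pair from certificates.** For the literal twist `W = [a₁,…,a₆]` and the literal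
(elliptic, globally minimal — instance hypotheses) `W₀ = [b₁,…,b₆]`: there exist `W₀`, a square-free `d ≠ 1` and a change
of variables `C` with `W₀` semistable, `p` good supersingular for `W₀` with `a_p(W₀) = 0`, every prime ramified in `ℚ(√d)`
different from `p` and good ORDINARY for `W₀`, and `C • W = W₀^{(d)}` — exactly the hypothesis list of the twist clause of BSTW
Thm. 1.3 / 1.5 (INTRO wording, binder `thm15_twist_pPart_OPEN`) at the pair, binder-free. DECIDED IN THE KERNEL from:
`(u, r, s, t)` and five rational identities (`smul_eq_quadraticTwist_of_eqs`), `gcd(Δ₀, c₄(W₀)) = 1`, `p ∤ Δ₀`,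
`#Ẽ₀(𝔽_p) = p + 1`, `|d|` square-free as a bounded check, an explicit list `L` containing every odd prime factor of `|d|`
with each `q ∈ L` prime, `≠ p`, odd, `q ∤ Δ₀`, `q ∤ q + 1 − #Ẽ₀(𝔽_q)`, and — only when `d ≢ 1 (mod 4)` — `2 ∤ Δ₀` with an
odd `𝔽₂`-point count. UNCONDITIONAL (a statement about two explicit equations); per pair; nothing booked.
[cite: BurungaleSkinnerTianWan2024, Thm. 1.3 (twist clause, p. 3; shape of the hypotheses only, nothing of the preprint asserted)]
[cite: SilvermanAEC2009, III.1 Table 3.1, VII.5 Prop. 5.1] [cite: IrelandRosen1990, Prop. 5.1.2 and §8.1] -/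
theorem exists_twistIntro_of_certs (hp2 : p ≠ 2) (d : ℤ) (u r s t : ℚ) (hu : u ≠ 0)
    (h1 : (a1 : ℚ) + 2 * s = 0)
    (h2' : (a2 : ℚ) - s * a1 + 3 * r - s ^ 2 = u ^ 2 * ((d : ℚ) * ((b1 : ℚ) ^ 2 + 4 * b2) / 4))
    (h3 : (a3 : ℚ) + r * a1 + 2 * t = 0)
    (h4 : (a4 : ℚ) - s * a3 + 2 * r * a2 - (t + r * s) * a1 + 3 * r ^ 2 - 2 * s * t =
      u ^ 4 * ((d : ℚ) ^ 2 * (2 * (b4 : ℚ) + b1 * b3) / 2))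
    (h6 : (a6 : ℚ) + r * a4 + r ^ 2 * a2 + r ^ 3 - t * a3 - t ^ 2 - r * t * a1 =
      u ^ 6 * ((d : ℚ) ^ 3 * ((b3 : ℚ) ^ 2 + 4 * b6) / 4))
    (hgcd : Int.gcd (discOf [b1, b2, b3, b4, b6]) (c4Of [b1, b2, b3, b4, b6]) = 1)
    (hpΔ : ¬ (p : ℤ) ∣ discOf [b1, b2, b3, b4, b6]) (hcnt : countPoints [b1, b2, b3, b4, b6] p = (p + 1 : ℕ))
    (hd : ∀ q < d.natAbs + 1, 2 ≤ q → ¬ q * q ∣ d.natAbs) (hd0 : d ≠ 0) (hd1 : d ≠ 1) (L : List ℕ)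
    (hLcov : ∀ q < d.natAbs + 1, q.Prime → q ∣ d.natAbs → q = 2 ∨ q ∈ L)
    (hL : ∀ q ∈ L, q.Prime ∧ q ≠ p ∧ q ≠ 2 ∧ ¬ (q : ℤ) ∣ discOf [b1, b2, b3, b4, b6] ∧
      ¬ (q : ℤ) ∣ (q : ℤ) + 1 - countPoints [b1, b2, b3, b4, b6] q)
    (h2 : d % 4 ≠ 1 → ¬ (2 : ℤ) ∣ discOf [b1, b2, b3, b4, b6] ∧
      ¬ (2 : ℤ) ∣ (2 : ℤ) + 1 - ((1 + Fintype.card {xy : ZMod 2 × ZMod 2 //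
      xy.2 ^ 2 + ((⟨b1, b2, b3, b4, b6⟩ : WeierstrassCurve ℤ).map (Int.castRingHom (ZMod 2))).a₁ * xy.1 * xy.2 +
        ((⟨b1, b2, b3, b4, b6⟩ : WeierstrassCurve ℤ).map (Int.castRingHom (ZMod 2))).a₃ * xy.2 =
      xy.1 ^ 3 + ((⟨b1, b2, b3, b4, b6⟩ : WeierstrassCurve ℤ).map (Int.castRingHom (ZMod 2))).a₂ * xy.1 ^ 2 +
        ((⟨b1, b2, b3, b4, b6⟩ : WeierstrassCurve ℤ).map (Int.castRingHom (ZMod 2))).a₄ * xy.1 +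
        ((⟨b1, b2, b3, b4, b6⟩ : WeierstrassCurve ℤ).map (Int.castRingHom (ZMod 2))).a₆} : ℕ) : ℤ)) :
    ∃ (W₀ : WeierstrassCurve ℚ) (_ : W₀.IsElliptic) (_ : W₀.IsGloballyMinimal) (d : ℤ) (C : VariableChange ℚ),
      Semistable W₀ ∧ GoodSS W₀ p ∧ W₀.frobeniusTrace p = 0 ∧ Squarefree d ∧ d ≠ 1 ∧
      (∀ (q : ℕ) [Fact q.Prime], RamifiedInQuadratic d q → q ≠ p ∧ GoodOrd W₀ q) ∧
      C • (⟨a1, a2, a3, a4, a6⟩ : WeierstrassCurve ℚ) = W₀.quadraticTwist (d : ℚ) := by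
  have hsst := semistable_of_certs b1 b2 b3 b4 b6 hgcd
  have hss := goodSS_of_certs b1 b2 b3 b4 b6 p hp2 hpΔ hcnt
  have hap := frobeniusTrace_eq_zero_of_certs b1 b2 b3 b4 b6 p hp2 hpΔ hcnt
  have hdn : Squarefree d.natAbs := by
    intro x hx
    have hn0 : d.natAbs ≠ 0 := Int.natAbs_ne_zero.mpr hd0
    have hxle : x ≤ d.natAbs := Nat.le_of_dvd (Nat.pos_of_ne_zero hn0) (dvd_trans (dvd_mul_right x x) hx)
    by_contra hx1
    rw [Nat.isUnit_iff] at hx1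
    have hx0 : x ≠ 0 := by rintro rfl; exact hn0 (Nat.eq_zero_of_zero_dvd (by simpa using hx))
    exact hd x (Nat.lt_succ_of_le hxle) (by omega) hx
  have hd' : Squarefree d := Int.squarefree_natAbs.mp hdn
  have hram : ∀ (q : ℕ) [Fact q.Prime], RamifiedInQuadratic d q →
      q ≠ p ∧ GoodOrd (⟨b1, b2, b3, b4, b6⟩ : WeierstrassCurve ℚ) q := by
    intro q hq h
    rcases ramifiedInQuadratic_cases hd' hq.out h with ⟨rfl, hd4⟩ | ⟨hq2, hqd, hqlt⟩
    · obtain ⟨h2Δ, hodd⟩ := h2 hd4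
      refine ⟨Ne.symm hp2, ?_⟩
      have h := goodOrd_two_of_certs b1 b2 b3 b4 b6 h2Δ hodd
      convert h
    · have hmem : q ∈ L := (hLcov q hqlt hq.out hqd).resolve_left hq2
      obtain ⟨-, hqp, -, hqΔ, hqa⟩ := hL q hmem
      exact ⟨hqp, goodOrd_of_certs b1 b2 b3 b4 b6 q hq2 hqΔ hqa⟩
  have hC := smul_eq_quadraticTwist_of_eqs a1 a2 a3 a4 a6 b1 b2 b3 b4 b6 d u r s t hu h1 h2' h3 h4 h6
  exact ⟨_, hEb, hMb, d, _, hsst, hss, hap, hd', hd1, hram, hC⟩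

/-- **The BODY-wording twist datum of a pair from certificates**: as `exists_twistIntro_of_certs` but the ramified primes of
`ℚ(√d)` need only be different from `p` and GOOD for `W₀` (`q ∤ Δ₀`; no point counts at them) — the hypothesis list of the
twist clause of BSTW Cor. 10.2 (BODY wording, binder `cor102_twist_pPart_OPEN`) at the pair, binder-free. UNCONDITIONAL;
per pair; nothing booked. [cite: BurungaleSkinnerTianWan2024, Cor. 10.2 (twist clause, p. 86; shape of the hypotheses only)]
[cite: SilvermanAEC2009, III.1 Table 3.1, VII.5 Prop. 5.1] -/
theorem exists_twistBody_of_certs (hp2 : p ≠ 2) (d : ℤ) (u r s t : ℚ) (hu : u ≠ 0)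
    (h1 : (a1 : ℚ) + 2 * s = 0)
    (h2' : (a2 : ℚ) - s * a1 + 3 * r - s ^ 2 = u ^ 2 * ((d : ℚ) * ((b1 : ℚ) ^ 2 + 4 * b2) / 4))
    (h3 : (a3 : ℚ) + r * a1 + 2 * t = 0)
    (h4 : (a4 : ℚ) - s * a3 + 2 * r * a2 - (t + r * s) * a1 + 3 * r ^ 2 - 2 * s * t =
      u ^ 4 * ((d : ℚ) ^ 2 * (2 * (b4 : ℚ) + b1 * b3) / 2))
    (h6 : (a6 : ℚ) + r * a4 + r ^ 2 * a2 + r ^ 3 - t * a3 - t ^ 2 - r * t * a1 =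
      u ^ 6 * ((d : ℚ) ^ 3 * ((b3 : ℚ) ^ 2 + 4 * b6) / 4))
    (hgcd : Int.gcd (discOf [b1, b2, b3, b4, b6]) (c4Of [b1, b2, b3, b4, b6]) = 1)
    (hpΔ : ¬ (p : ℤ) ∣ discOf [b1, b2, b3, b4, b6]) (hcnt : countPoints [b1, b2, b3, b4, b6] p = (p + 1 : ℕ))
    (hd : ∀ q < d.natAbs + 1, 2 ≤ q → ¬ q * q ∣ d.natAbs) (hd0 : d ≠ 0) (hd1 : d ≠ 1) (L : List ℕ)
    (hLcov : ∀ q < d.natAbs + 1, q.Prime → q ∣ d.natAbs → q = 2 ∨ q ∈ L)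
    (hL : ∀ q ∈ L, q.Prime ∧ q ≠ p ∧ ¬ (q : ℤ) ∣ discOf [b1, b2, b3, b4, b6])
    (h2 : d % 4 ≠ 1 → ¬ (2 : ℤ) ∣ discOf [b1, b2, b3, b4, b6]) :
    ∃ (W₀ : WeierstrassCurve ℚ) (_ : W₀.IsElliptic) (_ : W₀.IsGloballyMinimal) (d : ℤ) (C : VariableChange ℚ),
      Semistable W₀ ∧ GoodSS W₀ p ∧ W₀.frobeniusTrace p = 0 ∧ Squarefree d ∧ d ≠ 1 ∧
      (∀ (q : ℕ) [Fact q.Prime], RamifiedInQuadratic d q → q ≠ p ∧ W₀.HasGoodReductionAtPrime q) ∧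
      C • (⟨a1, a2, a3, a4, a6⟩ : WeierstrassCurve ℚ) = W₀.quadraticTwist (d : ℚ) := by
  have hIb := integralModelInt_lit b1 b2 b3 b4 b6
  have hsst := semistable_of_certs b1 b2 b3 b4 b6 hgcd
  have hss := goodSS_of_certs b1 b2 b3 b4 b6 p hp2 hpΔ hcnt
  have hap := frobeniusTrace_eq_zero_of_certs b1 b2 b3 b4 b6 p hp2 hpΔ hcnt
  have hdn : Squarefree d.natAbs := by
    intro x hx
    have hn0 : d.natAbs ≠ 0 := Int.natAbs_ne_zero.mpr hd0
    have hxle : x ≤ d.natAbs := Nat.le_of_dvd (Nat.pos_of_ne_zero hn0) (dvd_trans (dvd_mul_right x x) hx)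
    by_contra hx1
    rw [Nat.isUnit_iff] at hx1
    have hx0 : x ≠ 0 := by rintro rfl; exact hn0 (Nat.eq_zero_of_zero_dvd (by simpa using hx))
    exact hd x (Nat.lt_succ_of_le hxle) (by omega) hx
  have hd' : Squarefree d := Int.squarefree_natAbs.mp hdn
  have hgoodq : ∀ (q : ℕ) [Fact q.Prime], ¬ (q : ℤ) ∣ discOf [b1, b2, b3, b4, b6] →
      (⟨b1, b2, b3, b4, b6⟩ : WeierstrassCurve ℚ).HasGoodReductionAtPrime q := fun q _ hqΔ ↦
    hasGoodReductionAtPrime_of_not_dvd _ q (by rw [minimalDiscriminantInt_eq hIb, intCurve_Δ]; exact hqΔ)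
  have hram : ∀ (q : ℕ) [Fact q.Prime], RamifiedInQuadratic d q →
      q ≠ p ∧ (⟨b1, b2, b3, b4, b6⟩ : WeierstrassCurve ℚ).HasGoodReductionAtPrime q := by
    intro q hq h
    rcases ramifiedInQuadratic_cases hd' hq.out h with ⟨rfl, hd4⟩ | ⟨hq2, hqd, hqlt⟩
    · exact ⟨Ne.symm hp2, hgoodq 2 (h2 hd4)⟩
    · have hmem : q ∈ L := (hLcov q hqlt hq.out hqd).resolve_left hq2
      obtain ⟨-, hqp, hqΔ⟩ := hL q hmem
      exact ⟨hqp, hgoodq q hqΔ⟩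
  have hC := smul_eq_quadraticTwist_of_eqs a1 a2 a3 a4 a6 b1 b2 b3 b4 b6 d u r s t hu h1 h2' h3 h4 h6
  exact ⟨_, hEb, hMb, d, _, hsst, hss, hap, hd', hd1, hram, hC⟩

end Datum

/-! ### §4 The pair is an X7 pair; the (ram) witness on the twist -/

section PairCerts

variable (p : ℕ) [Fact p.Prime] (a1 a2 a3 a4 a6 : ℤ)
  [hEa : (⟨a1, a2, a3, a4, a6⟩ : WeierstrassCurve ℚ).IsElliptic]
  [hMa : (⟨a1, a2, a3, a4, a6⟩ : WeierstrassCurve ℚ).IsGloballyMinimal]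

/-- **The pair IS an X7 pair with `a_p = 0`** (bookkeeping for the census row, from the twist's own literal minimal
model): `p ∤ Δ`, `#Ẽ(𝔽_p) = p + 1` (good supersingular at the odd `p`, `a_p = 0`), and an ADDITIVE prime `q`
(`q ∣ Δ`, `q ∣ c₄`; `Supersingular.classX7_of_intModel`). Per pair; nothing booked.
[cite: SilvermanAEC2009, VII.5 Prop. 5.1(a) and (c)] -/
theorem classX7_of_certs (hp2 : p ≠ 2) (hpΔa : ¬ (p : ℤ) ∣ discOf [a1, a2, a3, a4, a6])
    (hcnta : countPoints [a1, a2, a3, a4, a6] p = (p + 1 : ℕ)) (q : ℕ) (hq : q.Prime)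
    (hqΔ : (q : ℤ) ∣ discOf [a1, a2, a3, a4, a6]) (hqc₄ : (q : ℤ) ∣ c4Of [a1, a2, a3, a4, a6]) :
    ClassX7 (⟨a1, a2, a3, a4, a6⟩ : WeierstrassCurve ℚ) p ∧
      (⟨a1, a2, a3, a4, a6⟩ : WeierstrassCurve ℚ).frobeniusTrace p = 0 := by
  have hIa := integralModelInt_lit a1 a2 a3 a4 a6
  have hn := natCard_point_eq_of_countPoints a1 a2 a3 a4 a6 p hp2 hpΔa hcnta
  refine ⟨classX7_of_intModel p hIa (by rw [intCurve_Δ]; exact hpΔa) hn (by push_cast; simp) q hq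
    (by rw [intCurve_Δ]; exact hqΔ) (by rw [intCurve_c₄]; exact hqc₄), ?_⟩
  exact frobeniusTrace_eq_zero_of_certs a1 a2 a3 a4 a6 p hp2 hpΔa hcnta

/-- **`Ram W p` from the literal minimal model**: a prime `ℓ ≠ p` with `ℓ ∣ Δ`, `ℓ ∤ c₄` (multiplicative reduction,
Silverman VII.5.1(b), `IntModel.hasMultiplicativeReductionAtPrime_of_intModel`) and `ℓ^v ∥ Δ = Δ_min` with `p ∤ v`.
Per pair; UNCONDITIONAL. [cite: SilvermanAEC2009, VII.5 Prop. 5.1(b)] [cite: SkinnerUrban2014, Thm. 2 (p. 3), second bullet (shape of (ram) only)] -/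
theorem ram_of_certs (ℓ v : ℕ) (hℓ : ℓ.Prime) (hℓp : ℓ ≠ p)
    (hℓΔ : (ℓ : ℤ) ∣ discOf [a1, a2, a3, a4, a6]) (hℓc₄ : ¬ (ℓ : ℤ) ∣ c4Of [a1, a2, a3, a4, a6])
    (hv : (ℓ : ℤ) ^ v ∣ discOf [a1, a2, a3, a4, a6]) (hv' : ¬ (ℓ : ℤ) ^ (v + 1) ∣ discOf [a1, a2, a3, a4, a6])
    (hpv : ¬ p ∣ v) : Ram (⟨a1, a2, a3, a4, a6⟩ : WeierstrassCurve ℚ) p := by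
  haveI : Fact ℓ.Prime := ⟨hℓ⟩
  have hIa := integralModelInt_lit a1 a2 a3 a4 a6
  refine ⟨ℓ, ‹_›, hℓp, hasMultiplicativeReductionAtPrime_of_intModel hIa ℓ (by rw [intCurve_Δ]; exact hℓΔ)
    (by rw [intCurve_c₄]; exact hℓc₄), ?_⟩
  rw [minimalDiscriminantInt_eq hIa, intCurve_Δ, padicValInt_eq_of_dvd_of_not_dvd ℓ hv hv']
  exact hpv

/-- **`BSTWScope.HasAuxWitness W p` for the twist, UNCONDITIONAL** — the S-scoped tiers' one extra hypothesis ON THE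
TWIST (the auxiliary (ram) prime `q` and imaginary quadratic field `L` of BSTW II §2.3 run «for the quadratic twist
g_K», §10.3): from `Ram W p` by the tree's `BSTWScope_hasAuxWitness_of_ram` (Dirichlet + CRT, class-number-free).
Per pair; closes nothing. [cite: SkinnerUrban2014, Thm. 2 (p. 3), second bullet (shape of (ram) only)] -/
theorem hasAuxWitness_of_certs (ℓ v : ℕ) (hℓ : ℓ.Prime) (hℓp : ℓ ≠ p)
    (hℓΔ : (ℓ : ℤ) ∣ discOf [a1, a2, a3, a4, a6]) (hℓc₄ : ¬ (ℓ : ℤ) ∣ c4Of [a1, a2, a3, a4, a6])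
    (hv : (ℓ : ℤ) ^ v ∣ discOf [a1, a2, a3, a4, a6]) (hv' : ¬ (ℓ : ℤ) ^ (v + 1) ∣ discOf [a1, a2, a3, a4, a6])
    (hpv : ¬ p ∣ v) : BSTWScope.HasAuxWitness (⟨a1, a2, a3, a4, a6⟩ : WeierstrassCurve ℚ) p :=
  BSTWScope_hasAuxWitness_of_ram _ p (ram_of_certs p a1 a2 a3 a4 a6 ℓ v hℓ hℓp hℓΔ hℓc₄ hv hv' hpv)

end PairCerts

end Summit.BirchSwinnertonDyer.BirchSwinnertonDyer.Theorems.X7Twist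

end
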